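import Literature.Analysis.FluidPDE.PassiveVectorTensorPropagatorBandKillAdjointApprox
import HarnessLib

/-!
# Low-mode capture for weak tensor-viscosity passive vectors: energy entering the ball `|k| ≤ L'` is
# `O(L' · sup|b| · time)` — the one-step (sharp-ball) version of the descent, no commutator, no ladder box

Analysis/FluidPDE proof file (theorems only; no definitions, no named facts).  For a weak solution `w` of the tensor-viscosity passive
vector equation (`A = 0`, `NearIso 𝔸 lo hi`, `0 ≤ lo`) whose `L²` datum has NO Fourier modes in the ball `|k| ≤ L'`, with energy
`‖w(t)‖₂ ≤ M₀` and a carrier bounded by `B` in the sup norm (a.e. time slices continuous), the energy captured by the ball obeys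
`Σ_{|k| ≤ L'} |ŵ(t)(k)|² ≤ (4π d L' B M₀ τ)²` for a.e. `t ∈ (0,τ)` (`ae_sum_freqBall_sq_norm_le`): the weighted Galerkin identity with the
SHARP ball weight (`ae_weighted_sum_sq_norm_mFourierCoeff_eq`, dissipation dropped by `ae_re_inner_symbT_nonneg`), the flux bound
`|∫⟨w, (b·∇) P_{L'} w⟩| ≤ d · B · ‖w‖₂ · 2πL' ‖P_{L'} w‖₂` (derivative on the band-limited test field, `convect_realTrigPoly` and the tail
tool of `TorusCubeFluxLocalisation` with an empty band), and the square-root Bihari step `ae_le_sq_of_ae_le_mul_setIntegral_sqrt`.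
Unlike the cube ladder (`PassiveVectorTensorCubeDescent*`) it needs no room between the ball and the support of the datum, so it serves
the small-frequency end of W3-E (ii).  §2 lifts it to the window propagator `U(s,s′)` and its adjoint (`IsPropagator.lowModeCapture`,
`IsPropagator.lowModeCapture_adjoint`), as in `PassiveVectorTensorPropagatorBandKillApprox`.  Consumer: cell `ad-ideate`, K1L_D
`stmt-AnomalousDissipation-27980`, `stub_effectiveFrameEnergyL_bandKill`.
## References
* R. Temam, *Navier–Stokes Equations* (1984), Ch. III §1 Lemma 1.2. [`Temam1984`]
* R. J. DiPerna, P.-L. Lions, Invent. Math. 98 (1989), §II.1 Lemma II.1. [`DiPernaLions1989`]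
* A. Pazy, *Semigroups of Linear Operators and Applications to PDE* (1983), Ch. 1 §1.10. [`Pazy1983`] -/

noncomputable section

open MeasureTheory Set Filter Complex UnitAddTorus Function Finset
open scoped ENNReal InnerProductSpace ComplexConjugate Topology

namespace Literature.Analysis.FluidPDE

namespace Torus

variable {d : Type*} [Fintype d] [DecidableEq d]

/-! ## §1 The weak-solution level -/

/-- **Fixed-time flux into the sharp ball**: for `u ∈ L²` with coefficients `X`, a continuous drift `b` with `‖b x‖ ≤ B`, and the ball
`F = freqBall L'`, `|∫⟨u, (b·∇) realTrigPoly F X⟩| ≤ d · B · 2πL' · ‖u‖₂ · √(Σ_{k∈F} ‖X k‖²)`.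
[cite: Temam1984, Ch. III §1 Lemma 1.2] -/
theorem abs_ballFlux_le {u : UnitAddTorus d → EuclideanSpace ℝ d} (hu : MemLp u 2 volume)
    {b : UnitAddTorus d → EuclideanSpace ℝ d} (hbc : Continuous b) {B : ℝ} (hB : ∀ x, ‖b x‖ ≤ B) (L' : ℕ) :
    |∫ x, ⟪u x, FunctionSpaces.Torus.convect b (FunctionSpaces.Torus.realTrigPoly (FunctionSpaces.Torus.freqBall L')
        (fun k => (((1 : ℝ) ^ 2 : ℝ) : ℂ) • mFourierCoeff (FunctionSpaces.EuclideanSpace.complexify ∘ u) k)) x⟫_ℝ| ≤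
      Fintype.card d * B * (2 * Real.pi * L') * Real.sqrt (∫ x, ‖u x‖ ^ 2) *
        Real.sqrt (∑ k ∈ FunctionSpaces.Torus.freqBall L', ‖mFourierCoeff (FunctionSpaces.EuclideanSpace.complexify ∘ u) k‖ ^ 2) := by
  classical
  set F : Finset (d → ℤ) := FunctionSpaces.Torus.freqBall L' with hF
  set X : (d → ℤ) → EuclideanSpace ℂ d := mFourierCoeff (FunctionSpaces.EuclideanSpace.complexify ∘ u) with hX
  have hFsym : ∀ k ∈ F, -k ∈ F := FunctionSpaces.Torus.neg_mem_freqBall_of_mem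
  have hXc : FunctionSpaces.Torus.IsConjSymm X := FunctionSpaces.Torus.isConjSymm_mFourierCoeff (hu.integrable one_le_two)
  have hB0 : 0 ≤ B := (norm_nonneg _).trans (hB 0)
  have e1 : (fun k => (((1 : ℝ) ^ 2 : ℝ) : ℂ) • X k) = X := by funext k; simp
  rw [e1]
  set θ : d → (d → ℤ) → EuclideanSpace ℂ d := fun a k => (2 * Real.pi * Complex.I * (k a)) • X k with hθ
  have hθc : ∀ a, FunctionSpaces.Torus.IsConjSymm (θ a) := fun a => hXc.deriv a
  have hba : ∀ a, Continuous fun x => b x a := fun a => (PiLp.continuous_apply 2 (fun _ : d => ℝ) a).comp hbc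
  -- the flux as a sum over the axes
  have hconv : ∀ x, ⟪u x, FunctionSpaces.Torus.convect b (FunctionSpaces.Torus.realTrigPoly F X) x⟫_ℝ =
      ∑ a, b x a * ⟪u x, FunctionSpaces.Torus.realTrigPoly F (θ a) x⟫_ℝ := by
    intro x
    rw [FunctionSpaces.Torus.convect_realTrigPoly, inner_sum]
    refine Finset.sum_congr rfl fun a _ => ?_
    rw [inner_smul_right]
  have hint : ∀ a, Integrable (fun x => b x a * ⟪u x, FunctionSpaces.Torus.realTrigPoly F (θ a) x⟫_ℝ) volume := fun a =>
    FunctionSpaces.Torus.integrable_mul_inner hu (hba a) (FunctionSpaces.Torus.continuous_realTrigPoly F (θ a))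
  rw [integral_congr_ae (ae_of_all _ hconv), integral_finsetSum _ fun a _ => hint a]
  -- each axis by the tail tool with an empty band
  have haxis : ∀ a, |∫ x, b x a * ⟪u x, FunctionSpaces.Torus.realTrigPoly F (θ a) x⟫_ℝ| ≤
      B * Real.sqrt (∫ x, ‖u x‖ ^ 2) * Real.sqrt (∑ k ∈ F, ‖θ a k‖ ^ 2) := by
    intro a
    refine FunctionSpaces.Torus.abs_integral_mul_inner_realTrigPoly_le_of_coeff_vanish hu (hba a) (B := ∅) (S := F)
      (fun k hk => absurd hk (Finset.notMem_empty k)) hFsym (t := 0) FunctionSpaces.Torus.isConjSymm_zero (hθc a) a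
      (fun y hy => absurd hy (Finset.notMem_empty y)) fun x => ?_
    rw [FunctionSpaces.Torus.realTrigPoly_zero]
    simp only [Pi.zero_apply, PiLp.zero_apply, sub_zero]
    exact ((Real.norm_eq_abs _).symm.le.trans (PiLp.norm_apply_le (b x) a)).trans (hB x)
  -- `Σ_{k∈F} ‖θ a k‖² ≤ (2πL')² Σ_{k∈F} ‖X k‖²`
  have hθle : ∀ a, ∑ k ∈ F, ‖θ a k‖ ^ 2 ≤ (2 * Real.pi * L') ^ 2 * ∑ k ∈ F, ‖X k‖ ^ 2 := by
    intro a
    rw [Finset.mul_sum]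
    refine Finset.sum_le_sum fun k hk => ?_
    have hka : |(k a : ℝ)| ≤ L' := by
      have h1 := FunctionSpaces.Torus.abs_apply_le_sqrt_freqNormSq k a
      have h2 : Real.sqrt (FunctionSpaces.Torus.freqNormSq k) ≤ L' := by
        rw [← Real.sqrt_sq (Nat.cast_nonneg L')]
        exact Real.sqrt_le_sqrt (FunctionSpaces.Torus.mem_freqBall.1 hk)
      exact h1.trans h2
    simp only [hθ, norm_smul, mul_pow]
    have hn : ‖(2 * Real.pi * Complex.I * (k a) : ℂ)‖ = 2 * Real.pi * |(k a : ℝ)| := by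
      rw [norm_mul, norm_mul, norm_mul, Complex.norm_I, mul_one, Complex.norm_ofNat, Complex.norm_real, Real.norm_eq_abs,
        abs_of_pos Real.pi_pos, ← Complex.ofReal_intCast, Complex.norm_real, Real.norm_eq_abs]
    rw [hn]
    have : (2 * Real.pi * |(k a : ℝ)|) ^ 2 ≤ (2 * Real.pi * L') ^ 2 := by
      apply pow_le_pow_left₀ (by positivity); nlinarith [Real.pi_pos]
    calc (2 * Real.pi * |(k a : ℝ)|) ^ 2 * ‖X k‖ ^ 2 ≤ (2 * Real.pi * L') ^ 2 * ‖X k‖ ^ 2 :=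
          mul_le_mul_of_nonneg_right this (sq_nonneg _)
      _ = _ := by ring
  calc |∑ a, ∫ x, b x a * ⟪u x, FunctionSpaces.Torus.realTrigPoly F (θ a) x⟫_ℝ|
      ≤ ∑ a, |∫ x, b x a * ⟪u x, FunctionSpaces.Torus.realTrigPoly F (θ a) x⟫_ℝ| := Finset.abs_sum_le_sum_abs _ _
    _ ≤ ∑ _a : d, B * Real.sqrt (∫ x, ‖u x‖ ^ 2) * ((2 * Real.pi * L') * Real.sqrt (∑ k ∈ F, ‖X k‖ ^ 2)) := by
        refine Finset.sum_le_sum fun a _ => (haxis a).trans (mul_le_mul_of_nonneg_left ?_ (by positivity))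
        calc Real.sqrt (∑ k ∈ F, ‖θ a k‖ ^ 2) ≤ Real.sqrt ((2 * Real.pi * L') ^ 2 * ∑ k ∈ F, ‖X k‖ ^ 2) := Real.sqrt_le_sqrt (hθle a)
          _ = (2 * Real.pi * L') * Real.sqrt (∑ k ∈ F, ‖X k‖ ^ 2) := by
              rw [Real.sqrt_mul (sq_nonneg _), Real.sqrt_sq (by positivity)]
    _ = Fintype.card d * B * (2 * Real.pi * L') * Real.sqrt (∫ x, ‖u x‖ ^ 2) * Real.sqrt (∑ k ∈ F, ‖X k‖ ^ 2) := by
        rw [Finset.sum_const, Finset.card_univ, nsmul_eq_mul]; ring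

namespace IsWeakTensorPassiveVectorOn

/-- **LOW-MODE CAPTURE (weak-solution level).**  `A = 0`, `NearIso 𝔸 lo hi`, `0 ≤ lo`; datum `w₀ ∈ L²` weakly divergence free with NO
modes in the ball `|k| ≤ L'`; energy `∫‖w(t)‖² ≤ M₀²` a.e.; carrier slices a.e. continuous and bounded by `B`.  Then for a.e. `t ∈ (0,τ)`
(`τ ≤ T`), `Σ_{|k| ≤ L'} |ŵ(t)(k)|² ≤ (4π d L' B M₀ τ)²`. [cite: Temam1984, Ch. III §1 Lemma 1.2] [cite: DiPernaLions1989, §II.1 Lemma II.1] -/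
theorem ae_sum_freqBall_sq_norm_le {T : ℝ} {𝔸 : Visc4 d} {b w : ℝ → UnitAddTorus d → EuclideanSpace ℝ d}
    {w₀ : UnitAddTorus d → EuclideanSpace ℝ d} (h : IsWeakTensorPassiveVectorOn 0 T 𝔸 b w₀ w)
    {lo hi : ℝ} (h𝔸 : NearIso 𝔸 lo hi) (hlo : 0 ≤ lo)
    (hw₀ : MemLp w₀ 2 volume) (hdiv₀ : FunctionSpaces.Torus.IsWeaklyDivFree w₀)
    {M₀ : ℝ} (hM₀ : 0 ≤ M₀) (hE : ∀ᵐ t ∂(volume.restrict (Ioo 0 T)), ∫ x, ‖w t x‖ ^ 2 ≤ M₀ ^ 2)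
    (L' : ℕ) (hoff : ∀ k ∈ FunctionSpaces.Torus.freqBall L', mFourierCoeff (FunctionSpaces.EuclideanSpace.complexify ∘ w₀) k = 0)
    (hbc : ∀ᵐ s ∂(volume.restrict (Ioo 0 T)), Continuous (b s))
    {B : ℝ} (hB0 : 0 ≤ B) (hB : ∀ᵐ s ∂(volume.restrict (Ioo 0 T)), ∀ x, ‖b s x‖ ≤ B)
    {τ : ℝ} (hτ : 0 ≤ τ) (hτT : τ ≤ T) :
    ∀ᵐ t ∂(volume.restrict (Ioo 0 τ)),
      ∑ k ∈ FunctionSpaces.Torus.freqBall L', ‖mFourierCoeff (FunctionSpaces.EuclideanSpace.complexify ∘ w t) k‖ ^ 2 ≤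
        (4 * Real.pi * Fintype.card d * L' * B * M₀ * τ) ^ 2 := by
  classical
  set F : Finset (d → ℤ) := FunctionSpaces.Torus.freqBall L' with hF
  set X : ℝ → (d → ℤ) → EuclideanSpace ℂ d := fun s => mFourierCoeff (FunctionSpaces.EuclideanSpace.complexify ∘ w s) with hX
  set E : ℝ → ℝ := fun s => ∑ k ∈ F, ‖X s k‖ ^ 2 with hEdef
  set FL : ℝ → ℝ := fun s => ∫ y, ⟪w s y, FunctionSpaces.Torus.convect (b s)
    (FunctionSpaces.Torus.realTrigPoly F (fun k => (((1 : ℝ) ^ 2 : ℝ) : ℂ) • X s k)) y⟫_ℝ with hFL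
  have hsubT : Ioo (0:ℝ) τ ⊆ Ioo 0 T := Ioo_subset_Ioo le_rfl hτT
  have hres : ∀ {P : ℝ → Prop}, (∀ᵐ s ∂(volume.restrict (Ioo 0 T)), P s) → ∀ᵐ s ∂(volume.restrict (Ioo 0 τ)), P s :=
    fun hP => ae_restrict_of_ae_restrict_of_subset hsubT hP
  -- measurability / integrability
  have hEint : IntegrableOn E (Ioo 0 T) volume := integrable_finsetSum _ fun k _ => h.integrableOn_norm_sq_mFourierCoeff k
  have hEm : AEStronglyMeasurable E (volume.restrict (Ioo 0 τ)) := (hEint.mono_set hsubT).aestronglyMeasurable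
  have hE0' : ∀ s, 0 ≤ E s := fun s => Finset.sum_nonneg fun k _ => sq_nonneg _
  have hconv : ∀ s, (fun y => ∑ k ∈ F, ((1 : ℝ) ^ 2) • FunctionSpaces.Torus.realTrigPoly {k} (fun k' => X s k') y) =
      FunctionSpaces.Torus.realTrigPoly F (fun k => (((1 : ℝ) ^ 2 : ℝ) : ℂ) • X s k) :=
    fun s => FunctionSpaces.Torus.sum_smul_realTrigPoly_singleton F (fun _ => (1 : ℝ) ^ 2) (X s)
  have hFLint : IntegrableOn FL (Ioo 0 T) volume := by
    have hi := h.integrableOn_weightedFlux F (fun _ => (1 : ℝ) ^ 2)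
    refine hi.congr_fun (fun s _ => ?_) measurableSet_Ioo
    simp only [zero_mul, add_zero, hFL, hX]
    rw [← hconv s]
  -- STEP 1: the weighted identity with the sharp ball weight ⇒ `E(t) ≤ 2 ∫ |FL|`
  have hstep1 : ∀ᵐ t ∂(volume.restrict (Ioo 0 T)), E t ≤ 2 * ∫ s in Ioc 0 t, |FL s| := by
    have hnn := h.ae_re_inner_symbT_nonneg h𝔸 hlo
    have hnn' := (ae_restrict_iff' (measurableSet_Ioo : MeasurableSet (Ioo (0:ℝ) T))).1 hnn
    filter_upwards [h.ae_weighted_sum_sq_norm_mFourierCoeff_eq hw₀ hdiv₀,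
      ae_restrict_mem (measurableSet_Ioo : MeasurableSet (Ioo (0:ℝ) T))] with t ht htT
    have hid := ht F (fun _ => (1 : ℝ) ^ 2)
    have hsub : Ioc 0 t ⊆ Ioo 0 T := fun s hs => ⟨hs.1, lt_of_le_of_lt hs.2 htT.2⟩
    have h0 : ∑ k ∈ F, (1 : ℝ) ^ 2 * ‖mFourierCoeff (FunctionSpaces.EuclideanSpace.complexify ∘ w₀) k‖ ^ 2 = 0 :=
      Finset.sum_eq_zero fun k hk => by rw [hoff k hk, norm_zero]; ring
    have hD : 0 ≤ ∫ s in Ioc 0 t, 4 * Real.pi ^ 2 * ∑ k ∈ F, (1 : ℝ) ^ 2 *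
        (⟪mFourierCoeff (FunctionSpaces.EuclideanSpace.complexify ∘ w s) k,
          symbT 𝔸 k (mFourierCoeff (FunctionSpaces.EuclideanSpace.complexify ∘ w s) k)⟫_ℂ).re := by
      refine setIntegral_nonneg_of_ae_restrict ((ae_restrict_iff' measurableSet_Ioc).2 (hnn'.mono fun s hs hsI => ?_))
      have := hs (hsub hsI)
      exact mul_nonneg (by positivity) (Finset.sum_nonneg fun k _ => mul_nonneg (sq_nonneg _) (this k))
    have hfl : ∫ s in Ioc 0 t, ((∫ y, ⟪w s y, FunctionSpaces.Torus.convect (b s) (fun y => ∑ k ∈ F, ((1 : ℝ) ^ 2) •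
          FunctionSpaces.Torus.realTrigPoly {k} (fun k' => mFourierCoeff (FunctionSpaces.EuclideanSpace.complexify ∘ w s) k') y) y⟫_ℝ) +
        0 * ∫ y, ⟪b s y, FunctionSpaces.Torus.convect (w s) (fun y => ∑ k ∈ F, ((1 : ℝ) ^ 2) •
          FunctionSpaces.Torus.realTrigPoly {k} (fun k' => mFourierCoeff (FunctionSpaces.EuclideanSpace.complexify ∘ w s) k') y) y⟫_ℝ) =
        ∫ s in Ioc 0 t, FL s := by
      refine setIntegral_congr_fun measurableSet_Ioc fun s _ => ?_
      simp only [zero_mul, add_zero, hFL, hX]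
      rw [← hconv s]
    have habs : ∫ s in Ioc 0 t, FL s ≤ ∫ s in Ioc 0 t, |FL s| :=
      integral_mono_ae (hFLint.mono_set hsub) (hFLint.mono_set hsub).abs (ae_of_all _ fun s => le_abs_self _)
    have hEt : E t = ∑ k ∈ F, (1 : ℝ) ^ 2 * ‖mFourierCoeff (FunctionSpaces.EuclideanSpace.complexify ∘ w t) k‖ ^ 2 := by
      simp only [hEdef, hX, one_pow, one_mul]
    rw [h0, hfl] at hid
    linarith
  -- STEP 2: the flux bound `|FL s| ≤ (c/2) √E(s)` a.e. on `(0,τ)`, `c = 4π d L' B M₀`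
  set c : ℝ := 4 * Real.pi * Fintype.card d * L' * B * M₀ with hc
  have hc0 : 0 ≤ c := by positivity
  have hflux : ∀ᵐ s ∂(volume.restrict (Ioo 0 τ)), |FL s| ≤ c / 2 * Real.sqrt (E s) := by
    filter_upwards [hres hbc, hres hB, hres h.ae_memLp_two, hres hE] with s hbc_s hB_s h2_s hE_s
    have hfix := abs_ballFlux_le h2_s hbc_s hB_s L'
    have hM : Real.sqrt (∫ y, ‖w s y‖ ^ 2) ≤ M₀ := (Real.sqrt_le_sqrt hE_s).trans (le_of_eq (Real.sqrt_sq hM₀))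
    calc |FL s| ≤ Fintype.card d * B * (2 * Real.pi * L') * Real.sqrt (∫ y, ‖w s y‖ ^ 2) * Real.sqrt (E s) := hfix
      _ ≤ Fintype.card d * B * (2 * Real.pi * L') * M₀ * Real.sqrt (E s) := by gcongr
      _ = c / 2 * Real.sqrt (E s) := by rw [hc]; ring
  -- STEP 3: integrate and apply the square-root Bihari step
  have hflux' := (ae_restrict_iff' (measurableSet_Ioo : MeasurableSet (Ioo (0:ℝ) τ))).1 hflux
  have hEB : ∀ᵐ t ∂(volume.restrict (Ioo 0 τ)), E t ≤ M₀ ^ 2 := by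
    filter_upwards [hres hE, hres h.ae_memLp_two] with t ht h2
    exact (sum_le_hasSum _ (fun k _ => sq_nonneg _) (FunctionSpaces.Torus.hasSum_sq_norm_mFourierCoeff_complexify h2)).trans ht
  have hEB' := (ae_restrict_iff' (measurableSet_Ioo : MeasurableSet (Ioo (0:ℝ) τ))).1 hEB
  have hSm' : AEStronglyMeasurable (fun s => Real.sqrt (E s)) (volume.restrict (Ioo 0 τ)) :=
    Real.continuous_sqrt.comp_aestronglyMeasurable hEm
  have hstep : ∀ᵐ t ∂(volume.restrict (Ioo 0 τ)), E t ≤ c * ∫ s in Ioc 0 t, Real.sqrt (E s) := by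
    filter_upwards [hres hstep1, ae_restrict_mem (measurableSet_Ioo : MeasurableSet (Ioo (0:ℝ) τ))] with t ht htI
    have hsub : Ioc 0 t ⊆ Ioo 0 τ := fun s hs => ⟨hs.1, lt_of_le_of_lt hs.2 htI.2⟩
    have hsub' : Ioc 0 t ⊆ Ioo 0 T := hsub.trans hsubT
    have hfin : volume (Ioc (0:ℝ) t) < ⊤ := by rw [Real.volume_Ioc]; exact ENNReal.ofReal_lt_top
    have hi1 : IntegrableOn (fun s => |FL s|) (Ioc 0 t) volume := (hFLint.mono_set hsub').abs
    have hi2 : IntegrableOn (fun s => c / 2 * Real.sqrt (E s)) (Ioc 0 t) volume := by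
      refine IntegrableOn.of_bound hfin ((hSm'.mono_measure (Measure.restrict_mono hsub le_rfl)).const_mul _)
        (c / 2 * M₀) ((ae_restrict_iff' measurableSet_Ioc).2 (hEB'.mono fun s hs hsI => ?_))
      rw [Real.norm_eq_abs, abs_of_nonneg (by positivity)]
      refine mul_le_mul_of_nonneg_left ?_ (by positivity)
      calc Real.sqrt (E s) ≤ Real.sqrt (M₀ ^ 2) := Real.sqrt_le_sqrt (hs (hsub hsI))
        _ = M₀ := Real.sqrt_sq hM₀
    have hmono : ∫ s in Ioc 0 t, |FL s| ≤ ∫ s in Ioc 0 t, c / 2 * Real.sqrt (E s) :=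
      integral_mono_ae hi1 hi2 ((ae_restrict_iff' measurableSet_Ioc).2 (hflux'.mono fun s hs hsI => hs (hsub hsI)))
    rw [integral_const_mul] at hmono
    calc E t ≤ 2 * ∫ s in Ioc 0 t, |FL s| := ht
      _ ≤ 2 * (c / 2 * ∫ s in Ioc 0 t, Real.sqrt (E s)) := by linarith
      _ = c * ∫ s in Ioc 0 t, Real.sqrt (E s) := by ring
  have hfinal := ae_le_sq_of_ae_le_mul_setIntegral_sqrt hc0 hτ hEm hEB hstep
  filter_upwards [hfinal] with t ht
  calc E t ≤ (c * τ) ^ 2 := ht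
    _ = (4 * Real.pi * Fintype.card d * L' * B * M₀ * τ) ^ 2 := by rw [hc]

end IsWeakTensorPassiveVectorOn

/-! ## §2 The window propagator and its adjoint -/

variable {T : ℝ} {𝔸 : Visc4 d} {lo hi : ℝ} {b : ℝ → UnitAddTorus d → EuclideanSpace ℝ d}
variable {U : ℝ → ℝ → (Lp (EuclideanSpace ℝ d) 2 (volume : Measure (UnitAddTorus d)) →L[ℝ]
  Lp (EuclideanSpace ℝ d) 2 (volume : Measure (UnitAddTorus d)))}

namespace IsPropagator

/-- **LOW-MODE CAPTURE FOR THE WINDOW PROPAGATOR, divergence-free data**: carrier bounded by `B` (a.e. slices continuous, weakly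
divergence free), `y ∈ L²` weakly divergence free with no Fourier modes in the ball `|k| ≤ L'`; then
`Σ_{|k| ≤ L'} |𝓕(U(s,s′) y)(k)|² ≤ (4π d L' B (s′−s))² ‖y‖²`. [cite: Temam1984, Ch. III §1 Lemma 1.2] [cite: DiPernaLions1989, §II.1 Lemma II.1] -/
theorem lowModeCapture_of_divFree (hU : IsPropagator T b 𝔸 U) (h𝔸 : NearIso 𝔸 lo hi) (hlo : 0 < lo)
    (hb : MemLp (FunctionSpaces.Torus.stLift b) ∞ (volume.restrict (Ioo 0 T ×ˢ univ)))
    (hbdiv : ∀ᵐ τ ∂(volume.restrict (Ioo 0 T)), FunctionSpaces.Torus.IsWeaklyDivFree (b τ))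
    (hbc : ∀ᵐ τ ∂(volume.restrict (Ioo 0 T)), Continuous (b τ))
    {B : ℝ} (hB0 : 0 ≤ B) (hB : ∀ᵐ τ ∂(volume.restrict (Ioo 0 T)), ∀ x, ‖b τ x‖ ≤ B)
    {s s' : ℝ} (hs : 0 ≤ s) (hss' : s < s') (hs'T : s' ≤ T) (L' : ℕ)
    (y : Lp (EuclideanSpace ℝ d) 2 (volume : Measure (UnitAddTorus d)))
    (hy : FunctionSpaces.Torus.IsWeaklyDivFree (y : UnitAddTorus d → EuclideanSpace ℝ d))
    (hyoff : ∀ k ∈ FunctionSpaces.Torus.freqBall L',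
      mFourierCoeff (FunctionSpaces.EuclideanSpace.complexify ∘ (y : UnitAddTorus d → EuclideanSpace ℝ d)) k = 0) :
    ∑ k ∈ FunctionSpaces.Torus.freqBall L', ‖mFourierCoeff (FunctionSpaces.EuclideanSpace.complexify ∘
        ((U s s' y : Lp (EuclideanSpace ℝ d) 2 volume) : UnitAddTorus d → EuclideanSpace ℝ d)) k‖ ^ 2 ≤
      (4 * Real.pi * Fintype.card d * L' * B * (s' - s)) ^ 2 * ‖y‖ ^ 2 := by
  classical
  have hsT : s < T := hss'.trans_le hs'T
  set τ : ℝ := s' - s with hτdef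
  have hτ : 0 < τ := sub_pos.2 hss'
  have hτT : τ ≤ T - s := by rw [hτdef]; linarith
  set ε2 : ℝ := (4 * Real.pi * Fintype.card d * L' * B * (s' - s)) ^ 2 with hε2
  have hε20 : 0 ≤ ε2 := sq_nonneg _
  have hym : MemLp (y : UnitAddTorus d → EuclideanSpace ℝ d) 2 volume := Lp.memLp y
  set w := windowSol h𝔸 hlo hb hbdiv hs hsT hym hy with hwdef
  have hsol := windowSol_spec h𝔸 hlo hb hbdiv hs hsT hym hy
  have hb' := memLp_top_stLift_shift_window (T := T) hb hs
  have hbc' : ∀ᵐ r ∂(volume.restrict (Ioo 0 (T - s))), Continuous (b (s + r)) :=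
    ae_restrict_Ioo_comp_add_left (P := fun t => Continuous (b t)) hbc hs (by linarith)
  have hB' : ∀ᵐ r ∂(volume.restrict (Ioo 0 (T - s))), ∀ x, ‖b (s + r) x‖ ≤ B :=
    ae_restrict_Ioo_comp_add_left (P := fun t => ∀ x, ‖b t x‖ ≤ B) hB hs (by linarith)
  have hE0 : (∫ z, ‖(y : UnitAddTorus d → EuclideanSpace ℝ d) z‖ ^ 2) = ‖y‖ ^ 2 := (norm_sq_eq_integral_norm_sq y).symm
  -- energy bound along `w` and the capture bound
  have hEle : ∀ᵐ t ∂(volume.restrict (Ioo 0 (T - s))), ∫ z, ‖w t z‖ ^ 2 ≤ ‖y‖ ^ 2 := by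
    filter_upwards [hsol.ae_integral_norm_sq_le h𝔸 hlo hym hy hb'] with t ht
    rwa [hE0] at ht
  have hcap := hsol.ae_sum_freqBall_sq_norm_le h𝔸 hlo.le hym hy (norm_nonneg y) hEle L' hyoff hbc' hB0 hB' hτ.le hτT
  -- representation of `U` by `w`
  have hrepr := hU.repr s hs hsT _ hym hy w hsol
  have hyLp : hym.toLp (y : UnitAddTorus d → EuclideanSpace ℝ d) = y := Lp.toLp_coeFn y hym
  have hsub : Ioo 0 τ ⊆ Ioo 0 (T - s) := Ioo_subset_Ioo le_rfl hτT
  have hgood : ∀ᵐ r ∂(volume.restrict (Ioo 0 τ)), ∃ hm : MemLp (w r) 2 volume, hm.toLp (w r) = U s (s + r) y ∧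
      (∑ k ∈ FunctionSpaces.Torus.freqBall L', ‖mFourierCoeff (FunctionSpaces.EuclideanSpace.complexify ∘ w r) k‖ ^ 2 ≤
        ε2 * ‖y‖ ^ 2) := by
    filter_upwards [hcap, ae_restrict_of_ae_restrict_of_subset hsub hrepr] with r hr hrep
    obtain ⟨hm, he⟩ := hrep
    rw [hyLp] at he
    refine ⟨hm, he, hr.trans (le_of_eq ?_)⟩
    simp only [hε2, hτdef]
    ring
  -- weak continuity at the endpoint, tested against the truncation of `U s s' y`
  have hcont : ∀ z : Lp (EuclideanSpace ℝ d) 2 (volume : Measure (UnitAddTorus d)),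
      ContinuousOn (fun r => ⟪U s (s + r) y, z⟫_ℝ) (Icc 0 τ) := by
    intro z
    have hc := hU.continuousOn s hs hsT.le y z
    refine (hc.comp (continuous_const.add continuous_id).continuousOn ?_)
    intro r hr
    exact ⟨by linarith [hr.1], by rw [hτdef] at hr; linarith [hr.2]⟩
  have hsτ : s + τ = s' := by rw [hτdef]; ring
  set S₀ : Finset (d → ℤ) := FunctionSpaces.Torus.freqBall L' with hS₀
  have hS₀sym : ∀ k ∈ S₀, -k ∈ S₀ := FunctionSpaces.Torus.neg_mem_freqBall_of_mem
  set u' : UnitAddTorus d → EuclideanSpace ℝ d := ((U s s' y : Lp (EuclideanSpace ℝ d) 2 volume) : UnitAddTorus d → EuclideanSpace ℝ d)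
    with hu'
  have hu'm : MemLp u' 2 volume := Lp.memLp _
  set c : (d → ℤ) → EuclideanSpace ℂ d := fun k => mFourierCoeff (FunctionSpaces.EuclideanSpace.complexify ∘ u') k with hc
  have hcsym : FunctionSpaces.Torus.IsConjSymm c := FunctionSpaces.Torus.isConjSymm_mFourierCoeff (hu'm.integrable one_le_two)
  have hzm : MemLp (FunctionSpaces.Torus.realTrigPoly S₀ c) 2 volume := FunctionSpaces.Torus.memLp_realTrigPoly S₀ c 2
  set z : Lp (EuclideanSpace ℝ d) 2 (volume : Measure (UnitAddTorus d)) := hzm.toLp _ with hz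
  set B2 : ℝ := ∑ k ∈ S₀, ‖c k‖ ^ 2 with hB2
  have hB20 : 0 ≤ B2 := Finset.sum_nonneg fun k _ => sq_nonneg _
  have hpair : ∀ v : Lp (EuclideanSpace ℝ d) 2 (volume : Measure (UnitAddTorus d)),
      ⟪v, z⟫_ℝ = ∑ k ∈ S₀, (inner ℂ (mFourierCoeff (FunctionSpaces.EuclideanSpace.complexify ∘
        (v : UnitAddTorus d → EuclideanSpace ℝ d)) k) (c k)).re := by
    intro v
    rw [MeasureTheory.L2.inner_def, ← FunctionSpaces.Torus.integral_inner_realTrigPoly_right hS₀sym hcsym (Lp.memLp v)]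
    refine integral_congr_ae ?_
    filter_upwards [hzm.coeFn_toLp] with ξ hξ
    rw [hz] ; simp only [hξ]
  have hlow : B2 ≤ ε2 * ‖y‖ ^ 2 := by
    set g : ℝ → ℝ := fun _ => Real.sqrt (ε2 * ‖y‖ ^ 2) * Real.sqrt B2 with hgdef
    have hgc : ContinuousOn g (Icc 0 τ) := continuousOn_const
    have hfg : ∀ᵐ r ∂(volume.restrict (Ioo 0 τ)), ⟪U s (s + r) y, z⟫_ℝ ≤ g r := by
      filter_upwards [hgood] with r hr
      obtain ⟨hm, he, h1⟩ := hr
      rw [hpair]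
      have hae : ((U s (s + r) y : Lp (EuclideanSpace ℝ d) 2 volume) : UnitAddTorus d → EuclideanSpace ℝ d) =ᵐ[volume] w r := by
        rw [← he]; exact hm.coeFn_toLp
      have e2 : ∀ k, mFourierCoeff (FunctionSpaces.EuclideanSpace.complexify ∘
          ((U s (s + r) y : Lp (EuclideanSpace ℝ d) 2 volume) : UnitAddTorus d → EuclideanSpace ℝ d)) k =
          mFourierCoeff (FunctionSpaces.EuclideanSpace.complexify ∘ w r) k := fun k =>
        FunctionSpaces.Torus.mFourierCoeff_congr_ae (hae.mono fun ξ hξ => by simp only [Function.comp_apply, hξ]) k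
      simp_rw [e2]
      calc ∑ k ∈ S₀, (inner ℂ (mFourierCoeff (FunctionSpaces.EuclideanSpace.complexify ∘ w r) k) (c k)).re
          ≤ ∑ k ∈ S₀, ‖mFourierCoeff (FunctionSpaces.EuclideanSpace.complexify ∘ w r) k‖ * ‖c k‖ :=
            Finset.sum_le_sum fun k _ => (Complex.re_le_norm _).trans (norm_inner_le_norm _ _)
        _ ≤ Real.sqrt (∑ k ∈ S₀, ‖mFourierCoeff (FunctionSpaces.EuclideanSpace.complexify ∘ w r) k‖ ^ 2) * Real.sqrt B2 :=
            Real.sum_mul_le_sqrt_mul_sqrt _ _ _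
        _ ≤ Real.sqrt (ε2 * ‖y‖ ^ 2) * Real.sqrt B2 :=
            mul_le_mul_of_nonneg_right (Real.sqrt_le_sqrt h1) (Real.sqrt_nonneg _)
    have hend := le_on_Icc_of_ae_le_of_continuousOn₂ hτ (hcont z) hgc hfg τ ⟨hτ.le, le_rfl⟩
    have hfτ : ⟪U s (s + τ) y, z⟫_ℝ = B2 := by
      rw [hsτ, hpair, hB2]
      refine Finset.sum_congr rfl fun k _ => ?_
      rw [← @inner_self_eq_norm_sq ℂ]
      rfl
    simp only [hgdef] at hend
    rw [hfτ] at hend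
    rcases hB20.eq_or_lt with hB | hBpos
    · rw [← hB]; positivity
    · have hsq : Real.sqrt B2 * Real.sqrt B2 = B2 := Real.mul_self_sqrt hB20
      have hspos : 0 < Real.sqrt B2 := Real.sqrt_pos.2 hBpos
      have h3 : Real.sqrt B2 ≤ Real.sqrt (ε2 * ‖y‖ ^ 2) := by
        have : Real.sqrt B2 * Real.sqrt B2 ≤ Real.sqrt (ε2 * ‖y‖ ^ 2) * Real.sqrt B2 := by rw [hsq]; exact hend
        exact le_of_mul_le_mul_right this hspos
      calc B2 = Real.sqrt B2 * Real.sqrt B2 := hsq.symm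
        _ ≤ Real.sqrt (ε2 * ‖y‖ ^ 2) * Real.sqrt (ε2 * ‖y‖ ^ 2) :=
            mul_le_mul h3 h3 (Real.sqrt_nonneg _) (Real.sqrt_nonneg _)
        _ = ε2 * ‖y‖ ^ 2 := Real.mul_self_sqrt (by positivity)
  exact hlow

/-- **LOW-MODE CAPTURE FOR THE WINDOW PROPAGATOR, all `L²` data** (Leray projection acts modewise and contracts). [cite: Temam1984, Ch. III §1 Lemma 1.2] -/
theorem lowModeCapture (hU : IsPropagator T b 𝔸 U) (h𝔸 : NearIso 𝔸 lo hi) (hlo : 0 < lo)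
    (hb : MemLp (FunctionSpaces.Torus.stLift b) ∞ (volume.restrict (Ioo 0 T ×ˢ univ)))
    (hbdiv : ∀ᵐ τ ∂(volume.restrict (Ioo 0 T)), FunctionSpaces.Torus.IsWeaklyDivFree (b τ))
    (hbc : ∀ᵐ τ ∂(volume.restrict (Ioo 0 T)), Continuous (b τ))
    {B : ℝ} (hB0 : 0 ≤ B) (hB : ∀ᵐ τ ∂(volume.restrict (Ioo 0 T)), ∀ x, ‖b τ x‖ ≤ B)
    {s s' : ℝ} (hs : 0 ≤ s) (hss' : s < s') (hs'T : s' ≤ T) (L' : ℕ)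
    (y : Lp (EuclideanSpace ℝ d) 2 (volume : Measure (UnitAddTorus d)))
    (hyoff : ∀ k ∈ FunctionSpaces.Torus.freqBall L',
      mFourierCoeff (FunctionSpaces.EuclideanSpace.complexify ∘ (y : UnitAddTorus d → EuclideanSpace ℝ d)) k = 0) :
    ∑ k ∈ FunctionSpaces.Torus.freqBall L', ‖mFourierCoeff (FunctionSpaces.EuclideanSpace.complexify ∘
        ((U s s' y : Lp (EuclideanSpace ℝ d) 2 volume) : UnitAddTorus d → EuclideanSpace ℝ d)) k‖ ^ 2 ≤
      (4 * Real.pi * Fintype.card d * L' * B * (s' - s)) ^ 2 * ‖y‖ ^ 2 := by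
  set P := (divFreeL2 d).starProjection with hP
  rw [hU.apply_eq_apply_starProjection s s' y]
  have hPoff : ∀ k ∈ FunctionSpaces.Torus.freqBall L',
      mFourierCoeff (FunctionSpaces.EuclideanSpace.complexify ∘
        ((P y : Lp (EuclideanSpace ℝ d) 2 (volume : Measure (UnitAddTorus d))) : UnitAddTorus d → EuclideanSpace ℝ d)) k = 0 := by
    intro k hk
    have h1 := norm_mFourierCoeff_starProjection_le y k
    rw [hyoff k hk, norm_zero] at h1
    exact norm_le_zero_iff.1 h1
  have h := hU.lowModeCapture_of_divFree h𝔸 hlo hb hbdiv hbc hB0 hB hs hss' hs'T L' (P y) (isWeaklyDivFree_starProjection y) hPoff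
  have hN : ‖P y‖ ^ 2 ≤ ‖y‖ ^ 2 := pow_le_pow_left₀ (norm_nonneg _) ((divFreeL2 d).norm_starProjection_apply_le y) 2
  exact h.trans (mul_le_mul_of_nonneg_left hN (sq_nonneg _))

/-- **LOW-MODE CAPTURE FOR THE ADJOINT WINDOW PROPAGATOR** (`(U s s′)†` is the propagator of the reversed problem, whose carrier has the
same sup bound). [cite: Pazy1983, Ch. 1 §1.10] [cite: Temam1984, Ch. III §1 Lemma 1.2] -/
theorem lowModeCapture_adjoint [Nonempty d] (hU : IsPropagator T b 𝔸 U) (h𝔸 : NearIso 𝔸 lo hi) (hlo : 0 < lo)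
    (hb : MemLp (FunctionSpaces.Torus.stLift b) ∞ (volume.restrict (Ioo 0 T ×ˢ univ)))
    (hbdiv : ∀ᵐ τ ∂(volume.restrict (Ioo 0 T)), FunctionSpaces.Torus.IsWeaklyDivFree (b τ))
    (hbc : ∀ᵐ τ ∂(volume.restrict (Ioo 0 T)), Continuous (b τ))
    {B : ℝ} (hB0 : 0 ≤ B) (hB : ∀ᵐ τ ∂(volume.restrict (Ioo 0 T)), ∀ x, ‖b τ x‖ ≤ B)
    {s s' : ℝ} (hs : 0 ≤ s) (hss' : s < s') (hs'T : s' ≤ T) (L' : ℕ)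
    (y : Lp (EuclideanSpace ℝ d) 2 (volume : Measure (UnitAddTorus d)))
    (hyoff : ∀ k ∈ FunctionSpaces.Torus.freqBall L',
      mFourierCoeff (FunctionSpaces.EuclideanSpace.complexify ∘ (y : UnitAddTorus d → EuclideanSpace ℝ d)) k = 0) :
    ∑ k ∈ FunctionSpaces.Torus.freqBall L', ‖mFourierCoeff (FunctionSpaces.EuclideanSpace.complexify ∘
        ((ContinuousLinearMap.adjoint (U s s') y : Lp (EuclideanSpace ℝ d) 2 volume) : UnitAddTorus d → EuclideanSpace ℝ d)) k‖ ^ 2 ≤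
      (4 * Real.pi * Fintype.card d * L' * B * (s' - s)) ^ 2 * ‖y‖ ^ 2 := by
  rw [hU.adjoint_eq h𝔸 hlo hb hbdiv hs hss' hs'T]
  have h𝔸' := (nearIso_majorTranspose_iff 𝔸 lo hi).2 h𝔸
  have hb' := memLp_top_stLift_reversed_window (T := T) (b := b) hb hs hs'T
  have hbdiv' := ae_isWeaklyDivFree_reversed_window (T := T) (b := b) hbdiv hs hs'T
  have hV := isPropagator_propagator h𝔸' hlo hb' hbdiv'
  have hbc' : ∀ᵐ r ∂(volume.restrict (Ioo 0 (s' - s))), Continuous (fun x => -b (s' - r) x) := by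
    filter_upwards [ae_restrict_Ioo_reversed_window (P := fun τ => Continuous (b τ)) hbc hs hs'T] with r hr
    exact hr.neg
  have hB' : ∀ᵐ r ∂(volume.restrict (Ioo 0 (s' - s))), ∀ x, ‖-b (s' - r) x‖ ≤ B := by
    filter_upwards [ae_restrict_Ioo_reversed_window (P := fun τ => ∀ x, ‖b τ x‖ ≤ B) hB hs hs'T] with r hr
    intro x; rw [norm_neg]; exact hr x
  have h := hV.lowModeCapture h𝔸' hlo hb' hbdiv' hbc' hB0 hB' le_rfl (sub_pos.2 hss') le_rfl L' y hyoff
  rw [sub_zero] at h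
  exact h

end IsPropagator

end Torus

end Literature.Analysis.FluidPDE

end
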